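import Literature.Analysis.FluidPDE.GradientRegularityCriteriaProofs
import Literature.Analysis.FluidPDE.DivCurlLpEstimate
import Literature.Analysis.FluidPDE.ConstantinDirectionDissipationProofs
import Literature.Analysis.FluidPDE.SobolevWholeSpace
import Literature.Analysis.FluidPDE.MorreySupBound
import HarnessLib

/-!
# Beirão da Veiga's regularity criterion on `ℝ³` in vorticity form (`ω ∈ L^q(0,T; L^r)`, `2/q + 3/r = 2`)

search for candidate a priori estimates; no regularity claim (cell `pub-nsfunc`, literature seat:
a published criterion as a THEOREM; nothing new).

The tree's `BeiraoDaVeiga1995_gradientCriterion_holds` (`GradientRegularityCriteriaProofs.lean`)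
is Beirão da Veiga's criterion in GRADIENT form: a classical solution of the unforced
Navier–Stokes system on `ℝ³ × [0,T)` which is Leray–Hopf from its datum and has
`∇u ∈ L^q(0,T; L^r(ℝ³))`, `2/q + 3/r = 2`, `1 < q < ∞`, extends past `T`. Chae (Rev. Mat.
Iberoam. 23 (2007), p. 372, (1.8)): "Beirão da Veiga obtained regularity condition in terms of
`∇v`, which is equivalent to the one in terms of the vorticity due to the Calderón–Zygmund
inequality. This states that if the vorticity `ω = curl v` of the weak solution `v` satisfies
`ω ∈ L^r(0,T; L^p(ℝ³))`, `2/r + 3/p ≤ 2`, for `3/2 < p ≤ ∞`, then `v` becomes regular" (Beirão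
da Veiga, C. R. Acad. Sci. Paris 321 (1995) 405–408).

* `BeiraoDaVeiga1995_vorticityCriterion_of_le_six` — **the vorticity form, PROVED for
  `3/2 < r ≤ 6`** (i.e. `4/3 ≤ q < ∞`): the tree's Calderón–Zygmund / div–curl estimate
  `exists_eLpNorm_fderiv_le_curl_of_isDivFree_of_eLpNorm_lt_top` (`DivCurlLpEstimate.lean`)
  converts `‖ω(t)‖_{L^r}` into `‖∇u(t)‖_{L^r}` slice by slice — using the `L²` tail of the
  energy class for `r ≤ 2` and, for `2 < r ≤ 6`, the `L⁶` tail of the slices with `∇u(t) ∈ L²`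
  (a.e. `t`, Leray–Hopf dissipation + Sobolev) — and the gradient criterion concludes. The
  remaining printed range `6 < r ≤ ∞` needs an a priori `L^r` tail of the slices, supplied by
  the next item.
* `BeiraoDaVeiga1995_vorticityCriterion` — **the vorticity form for the whole printed range
  `3/2 < r < ∞`** (`1 < q < ∞`; the endpoint `r = ∞`, `q = 1` is the Beale–Kato–Majda criterion
  and is not part of this statement): for `r > 6` and a.e. `t`, `ω(t) ∈ L² ∩ L^r ⊂ L⁶`
  (`∇u(t) ∈ L²`, Lebesgue interpolation), so `∇u(t) ∈ L⁶` by the div–curl estimate with the `L⁶`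
  tail, so `u(t) ∈ L^∞` by Morrey's sup bound (`MorreySupBound.lean`, Adams 1975 Lemma 5.15 /
  Corollary 5.16, Gilbarg–Trudinger Theorem 7.10 case `p > n`), so `u(t) ∈ L⁶ ∩ L^∞ ⊂ L^r` and the
  div–curl estimate with the `L^r` tail gives `‖∇u(t)‖_{L^r} ≤ C_r‖ω(t)‖_{L^r}`; the range
  `r ≤ 6` is the previous item.

## Mathlib / tree search

Tree: `BeiraoDaVeiga1995_gradientCriterion_holds`, `bdv_exponents`
(`GradientRegularityCriteriaProofs`), `exists_eLpNorm_fderiv_le_curl_of_isDivFree_of_eLpNorm_lt_top`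
(`DivCurlLpEstimate`), `IsLerayHopfOn.lintegral_frobeniusNormSq_fderiv_of_classical`
(`ConstantinDirectionDissipationProofs`), `IsLerayHopfOn.eEnergy_le_datum`, `eEnergy_eq_eLpNorm_sq`,
`eLpNorm_six_le_eLpNorm_fderiv_two` (`SobolevWholeSpace`), `sq_opNorm_le_frobeniusNormSq`,
`IsSmoothSpaceTimeOn.fderiv_slice`, `memLp_of_eLpNorm_fderiv_lt_top` (`MorreySupBound`),
`lintegral_rpow_interpolate` (`LerayHopfH1Test`), `norm_curl_le` (`TaoEnstrophyLocalisation`).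
Mathlib: `ae_lt_top'`, `AEMeasurable.lintegral_prod_right'`,
`eLpNorm_lt_top_iff_lintegral_rpow_enorm_lt_top`.

## References

* H. Beirão da Veiga, *Concerning the regularity problem for the solutions of the Navier–Stokes
  equations*, C. R. Acad. Sci. Paris Sér. I 321 (1995) 405–408 (vorticity form; as restated by
  Chae, Rev. Mat. Iberoam. 23 (2007) 371–384, p. 372 (1.8), held: paper:doi-10-4171-rmi-498).
  [BeiraoDaVeiga1995CR]
* H. Beirão da Veiga, Chinese Ann. Math. Ser. B 16 (1995) 407–412 (gradient form).
  [BeiraoDaVeiga1995]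
* L. C. Berselli, G. P. Galdi, Proc. Amer. Math. Soc. 130 (2002), (1.3). [BerselliGaldi2002]
* A. J. Majda, A. L. Bertozzi, *Vorticity and incompressible flow* (2002), (11.9). [MajdaBertozziCUP2002]
* R. A. Adams, *Sobolev Spaces* (1975), Lemma 5.15, Corollary 5.16. [Adams1975]
-/

noncomputable section

open MeasureTheory Set Filter Topology Function Metric
open scoped ENNReal NNReal ContDiff

namespace Literature.Analysis.FluidPDE

section VorticityForm

variable {ν T : ℝ} {u : ℝ → EuclideanSpace ℝ (Fin 3) → EuclideanSpace ℝ (Fin 3)}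
  {p : ℝ → EuclideanSpace ℝ (Fin 3) → ℝ}

/-- **Every slice of a classical Leray–Hopf solution has finite energy**:
`‖u(t)‖_{L²} < ∞` for `t ∈ [0, T)` (energy inequality from the datum). [folklore] -/
private theorem eLpNorm_two_slice_lt_top (hlh : IsLerayHopfOn T ν 0 (u 0) u) (hν : 0 < ν)
    {t : ℝ} (ht : t ∈ Ico 0 T) : eLpNorm (u t) 2 volume < ⊤ := by
  have h := hlh.eEnergy_le_datum hν.le (Ico_subset_Icc_self ht)
  rw [eEnergy_eq_eLpNorm_sq] at h
  have h2 : eLpNorm (u t) 2 volume ^ 2 < ⊤ := lt_of_le_of_lt h ENNReal.ofReal_lt_top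
  by_contra htop
  rw [not_lt, top_le_iff] at htop
  rw [htop, ENNReal.top_pow (by norm_num)] at h2
  exact lt_irrefl _ h2

/-- **Almost every slice of a classical Leray–Hopf solution has `∇u(t) ∈ L²`** (the dissipation
`∫₀ᵀ∫|∇u|²_F < ∞` of the energy inequality, read through the classical gradient, and Tonelli
measurability of the slice integrals of the jointly smooth `∇u`). [folklore] -/
private theorem ae_eLpNorm_fderiv_two_lt_top (hns : IsClassicalNSSolutionOn (Ico 0 T) ν 0 u p)
    (hlh : IsLerayHopfOn T ν 0 (u 0) u) (hT : 0 < T) :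
    ∀ᵐ t ∂(volume.restrict (Ioo 0 T)), eLpNorm (fderiv ℝ (u t)) 2 volume < ⊤ := by
  obtain ⟨hfin, -⟩ := hlh.lintegral_frobeniusNormSq_fderiv_of_classical hns hT
  -- measurability in time of the slice integrals `t ↦ ∫ ‖∇u(t)‖²`
  have hD : IsSmoothSpaceTimeOn (Ico 0 T) (fun t x => fderiv ℝ (u t) x) :=
    hns.smooth_velocity.fderiv_slice (uniqueDiffOn_Ico 0 T)
  have hc : ContinuousOn (fun z : ℝ × EuclideanSpace ℝ (Fin 3) => fderiv ℝ (u z.1) z.2)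
      (Ioo 0 T ×ˢ univ) :=
    hD.continuousOn.mono (prod_mono Ioo_subset_Ico_self Subset.rfl)
  have hmeas : AEStronglyMeasurable (fun z : ℝ × EuclideanSpace ℝ (Fin 3) => fderiv ℝ (u z.1) z.2)
      ((volume.restrict (Ioo 0 T)).prod volume) := by
    rw [Measure.restrict_prod_eq_prod_univ]
    exact hc.aestronglyMeasurable (measurableSet_Ioo.prod MeasurableSet.univ)
  have hG : AEMeasurable (fun t => ∫⁻ x, ‖fderiv ℝ (u t) x‖ₑ ^ 2) (volume.restrict (Ioo 0 T)) :=
    (hmeas.enorm.pow_const 2).lintegral_prod_right'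
  -- `∫ ‖∇u(t)‖² ≤ ∫ |∇u(t)|²_F`, whose time integral is finite
  have hle : ∀ t, (∫⁻ x, ‖fderiv ℝ (u t) x‖ₑ ^ 2) ≤
      ∫⁻ x, ENNReal.ofReal (frobeniusNormSq (fderiv ℝ (u t) x)) := fun t =>
    lintegral_mono fun x => by
      rw [← ofReal_norm, ← ENNReal.ofReal_pow (norm_nonneg _)]
      exact ENNReal.ofReal_le_ofReal (sq_opNorm_le_frobeniusNormSq _)
  have hfin' : (∫⁻ t in Ioo 0 T, ∫⁻ x, ‖fderiv ℝ (u t) x‖ₑ ^ 2) ≠ ⊤ :=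
    ne_top_of_le_ne_top hfin (lintegral_mono fun t => hle t)
  filter_upwards [ae_lt_top' hG hfin'] with t ht
  rw [eLpNorm_lt_top_iff_lintegral_rpow_enorm_lt_top (by norm_num) (by norm_num)]
  simpa [ENNReal.toReal_ofNat] using ht

/-- **Beirão da Veiga's criterion in vorticity form on `ℝ³`, range `3/2 < r ≤ 6`.** Let `ν > 0`,
`T > 0`, and let `(u, p)` be a classical solution of the unforced Navier–Stokes system on
`ℝ³ × [0, T)` which is Leray–Hopf from the rapidly decaying datum `u 0`. If the vorticity satisfies
`ω = curl u ∈ L^q(0, T; L^r(ℝ³))` with `2/q + 3/r = 2`, `1 < q < ∞` and `r ≤ 6` (so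
`3/2 < r ≤ 6`, `4/3 ≤ q < ∞`), then `u` extends to a classical solution past `T`. Proof:
`‖∇u(t)‖_{L^r} ≤ C_r ‖ω(t)‖_{L^r}` for a.e. `t` by the div–curl estimate
(`exists_eLpNorm_fderiv_le_curl_of_isDivFree_of_eLpNorm_lt_top` with the `L²` tail of the energy
class when `r ≤ 2`, with the `L⁶` tail `‖u(t)‖₆ ≤ K‖∇u(t)‖₂ < ∞` for a.e. `t` when `2 < r ≤ 6`),
hence `∇u ∈ L^q(0,T; L^r)` and the gradient criterion `BeiraoDaVeiga1995_gradientCriterion_holds`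
applies. Printed (as restated by Chae): "`ω ∈ L^r(0,T; L^p(ℝ³))`, `2/r + 3/p ≤ 2`, `3/2 < p ≤ ∞`
⇒ regular"; the range `6 < p ≤ ∞` and the inequality case are not covered by this theorem. [cite: Chae2007RMI, p. 372 (1.8) (restating Beirão da Veiga, C. R. Acad. Sci. Paris 321 (1995) 405–408); BerselliGaldi2002, (1.3) p. 3586] -/
theorem BeiraoDaVeiga1995_vorticityCriterion_of_le_six :
    ∀ (ν T : ℝ), 0 < ν → 0 < T →
    ∀ (u : ℝ → EuclideanSpace ℝ (Fin 3) → EuclideanSpace ℝ (Fin 3))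
      (p : ℝ → EuclideanSpace ℝ (Fin 3) → ℝ),
      IsClassicalNSSolutionOn (Ico 0 T) ν 0 u p →
      IsLerayHopfOn T ν 0 (u 0) u →
      HasRapidSpatialDecay (u 0) →
      ∀ (q r : ℝ≥0∞), 1 < q → q < ⊤ → 2 / q + 3 / r = 2 → r ≤ 6 →
        MemLqLp q r (fun t x => curl (u t) x) (Ioo 0 T) →
        HasSmoothExtensionPast ν 0 u T := by
  intro ν T hν hT u p hns hlh hdec q r h1q hqtop hqr hr6 hω
  obtain ⟨hrtop, hr32, -⟩ := bdv_exponents h1q hqtop hqr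
  have h32top : (3 / 2 : ℝ≥0∞) ≠ ⊤ := ENNReal.div_ne_top (by norm_num) (by norm_num)
  have h32 : (3 / 2 : ℝ) < r.toReal := by
    have h := (ENNReal.toReal_lt_toReal h32top hrtop).2 hr32
    rw [ENNReal.toReal_div] at h
    norm_num at h
    exact h
  have h1r : 1 < r :=
    (ENNReal.toReal_lt_toReal ENNReal.one_ne_top hrtop).1 (by rw [ENNReal.toReal_one]; linarith)
  have hrinv : 1 / r.toReal < 2 / 3 := by
    rw [div_lt_div_iff₀ (by linarith) (by norm_num)]
    linarith
  -- slice data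
  have hsl : ∀ t ∈ Ico 0 T, ContDiff ℝ ∞ (u t) ∧ VectorCalculus.IsDivFree (u t) ∧
      eLpNorm (u t) 2 volume < ⊤ := fun t ht =>
    ⟨hns.contDiff_velocity ht, hns.divFree t ht, eLpNorm_two_slice_lt_top hlh hν ht⟩
  -- the a.e. slice bound `‖∇u(t)‖_r ≤ C ‖ω(t)‖_r`
  have key : ∃ C : ℝ≥0, ∀ᵐ t ∂(volume.restrict (Ioo 0 T)),
      eLpNorm (fderiv ℝ (u t)) r volume ≤ C * eLpNorm (curl (u t)) r volume := by
    by_cases hr2 : r ≤ 2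
    · -- energy class: `L²` tail, `3(1/r - 1/2) < 1`
      obtain ⟨C, hC⟩ := exists_eLpNorm_fderiv_le_curl_of_isDivFree_of_eLpNorm_lt_top (s := 2)
        h1r hr2 (by norm_num) (by simp only [ENNReal.toReal_ofNat]; linarith)
      refine ⟨C, ?_⟩
      filter_upwards [ae_restrict_mem measurableSet_Ioo] with t ht
      obtain ⟨h1, h2, h3⟩ := hsl t (Ioo_subset_Ico_self ht)
      exact hC (u t) h1 h2 h3
    · -- `2 < r ≤ 6`: `L⁶` tail from `∇u(t) ∈ L²` (a.e. `t`) and Sobolev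
      rw [not_le] at hr2
      have hrinv' : 1 / r.toReal < 1 / 2 := by
        have h2r : (2 : ℝ) < r.toReal := by
          have h := (ENNReal.toReal_lt_toReal ENNReal.ofNat_ne_top hrtop).2 hr2
          simpa using h
        rw [div_lt_div_iff₀ (by linarith) (by norm_num)]
        linarith
      obtain ⟨C, hC⟩ := exists_eLpNorm_fderiv_le_curl_of_isDivFree_of_eLpNorm_lt_top (s := 6)
        h1r hr6 (by norm_num) (by simp only [ENNReal.toReal_ofNat]; linarith)
      refine ⟨C, ?_⟩
      filter_upwards [ae_restrict_mem measurableSet_Ioo, ae_eLpNorm_fderiv_two_lt_top hns hlh hT]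
        with t ht hDt
      obtain ⟨h1, h2, h3⟩ := hsl t (Ioo_subset_Ico_self ht)
      have h6 : eLpNorm (u t) 6 volume < ⊤ := by
        refine lt_of_le_of_lt (eLpNorm_six_le_eLpNorm_fderiv_two
          (volume : Measure (EuclideanSpace ℝ (Fin 3))) (F := EuclideanSpace ℝ (Fin 3))
          finrank_euclideanSpace_fin (h1.of_le one_le_infty) h3) ?_
        exact ENNReal.mul_lt_top ENNReal.coe_lt_top hDt
      exact hC (u t) h1 h2 h6
  obtain ⟨C, hC⟩ := key
  -- `∇u ∈ L^q(0,T; L^r)`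
  have hgrad : MemLqLp q r (fun t x => fderiv ℝ (u t) x) (Ioo 0 T) := by
    obtain ⟨hω1, hω2⟩ := hω
    refine ⟨?_, ?_⟩
    · filter_upwards [hC, hω1, ae_restrict_mem measurableSet_Ioo] with t ht hωt htI
      have hcont : Continuous (fderiv ℝ (u t)) :=
        (hns.contDiff_velocity (Ioo_subset_Ico_self htI)).continuous_fderiv (by simp)
      exact ⟨hcont.aestronglyMeasurable,
        lt_of_le_of_lt ht (ENNReal.mul_lt_top ENNReal.coe_lt_top hωt.eLpNorm_lt_top)⟩
    · -- `‖t ↦ ‖∇u(t)‖_r‖_{L^q} ≤ C ‖t ↦ ‖ω(t)‖_r‖_{L^q} < ∞`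
      rw [eLqLpNorm_def] at hω2 ⊢
      have hmono : eLpNorm (fun t => (eLpNorm (fun x => fderiv ℝ (u t) x) r volume).toReal) q
          (volume.restrict (Ioo 0 T)) ≤
          eLpNorm (fun t => (C : ℝ) * (eLpNorm (fun x => curl (u t) x) r volume).toReal) q
            (volume.restrict (Ioo 0 T)) := by
        refine eLpNorm_mono_ae ?_
        filter_upwards [hC, hω1] with t ht hωt
        rw [Real.norm_of_nonneg ENNReal.toReal_nonneg, Real.norm_of_nonneg (by positivity)]
        have hfin : (C : ℝ≥0∞) * eLpNorm (curl (u t)) r volume ≠ ⊤ :=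
          ENNReal.mul_ne_top ENNReal.coe_ne_top hωt.eLpNorm_lt_top.ne
        have := ENNReal.toReal_mono hfin ht
        rwa [ENNReal.toReal_mul, ENNReal.coe_toReal] at this
      refine lt_of_le_of_lt hmono ?_
      rw [show (fun t => (C : ℝ) * (eLpNorm (fun x => curl (u t) x) r volume).toReal) =
          (C : ℝ) • fun t => (eLpNorm (fun x => curl (u t) x) r volume).toReal from rfl,
        eLpNorm_const_smul]
      exact ENNReal.mul_lt_top enorm_lt_top hω2
  exact BeiraoDaVeiga1995_gradientCriterion_holds ν T hν hT u p hns hlh hdec q r h1q hqtop hqr hgrad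

/-- From an a.e.-in-time slice bound `‖∇u(t)‖_{L^r} ≤ C ‖ω(t)‖_{L^r}` and `ω ∈ L^q(0,T;L^r)` to
`∇u ∈ L^q(0,T;L^r)` (monotonicity of the mixed norm; the slices `∇u(t)` are continuous, hence
strongly measurable). [folklore] -/
private theorem memLqLp_fderiv_of_ae_le (hns : IsClassicalNSSolutionOn (Ico 0 T) ν 0 u p)
    {q r : ℝ≥0∞} {C : ℝ≥0}
    (hC : ∀ᵐ t ∂(volume.restrict (Ioo 0 T)),
      eLpNorm (fderiv ℝ (u t)) r volume ≤ C * eLpNorm (curl (u t)) r volume)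
    (hω : MemLqLp q r (fun t x => curl (u t) x) (Ioo 0 T)) :
    MemLqLp q r (fun t x => fderiv ℝ (u t) x) (Ioo 0 T) := by
  obtain ⟨hω1, hω2⟩ := hω
  refine ⟨?_, ?_⟩
  · filter_upwards [hC, hω1, ae_restrict_mem measurableSet_Ioo] with t ht hωt htI
    have hcont : Continuous (fderiv ℝ (u t)) :=
      (hns.contDiff_velocity (Ioo_subset_Ico_self htI)).continuous_fderiv (by simp)
    exact ⟨hcont.aestronglyMeasurable,
      lt_of_le_of_lt ht (ENNReal.mul_lt_top ENNReal.coe_lt_top hωt.eLpNorm_lt_top)⟩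
  · -- `‖t ↦ ‖∇u(t)‖_r‖_{L^q} ≤ C ‖t ↦ ‖ω(t)‖_r‖_{L^q} < ∞`
    rw [eLqLpNorm_def] at hω2 ⊢
    have hmono : eLpNorm (fun t => (eLpNorm (fun x => fderiv ℝ (u t) x) r volume).toReal) q
        (volume.restrict (Ioo 0 T)) ≤
        eLpNorm (fun t => (C : ℝ) * (eLpNorm (fun x => curl (u t) x) r volume).toReal) q
          (volume.restrict (Ioo 0 T)) := by
      refine eLpNorm_mono_ae ?_
      filter_upwards [hC, hω1] with t ht hωt
      rw [Real.norm_of_nonneg ENNReal.toReal_nonneg, Real.norm_of_nonneg (by positivity)]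
      have hfin : (C : ℝ≥0∞) * eLpNorm (curl (u t)) r volume ≠ ⊤ :=
        ENNReal.mul_ne_top ENNReal.coe_ne_top hωt.eLpNorm_lt_top.ne
      have := ENNReal.toReal_mono hfin ht
      rwa [ENNReal.toReal_mul, ENNReal.coe_toReal] at this
    refine lt_of_le_of_lt hmono ?_
    rw [show (fun t => (C : ℝ) * (eLpNorm (fun x => curl (u t) x) r volume).toReal) =
        (C : ℝ) • fun t => (eLpNorm (fun x => curl (u t) x) r volume).toReal from rfl,
      eLpNorm_const_smul]
    exact ENNReal.mul_lt_top enorm_lt_top hω2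

/-- **Slices with `∇u(t) ∈ L²` and `ω(t) ∈ L^r`, `r > 6`, lie in `L^r`.** For a smooth
divergence-free field `v` on `ℝ³` of finite energy with `‖Dv‖_{L²} < ∞` and `‖curl v‖_{L^r} < ∞`
for some `6 < r < ∞`: `curl v ∈ L² ∩ L^r ⊂ L⁶` (Lebesgue interpolation), hence `Dv ∈ L⁶` (the
div–curl estimate with the `L⁶` tail `‖v‖₆ ≤ K‖Dv‖₂`), hence `v ∈ L^s` for every `6 ≤ s ≤ ∞`
by Morrey's embedding `W^{1,6}(ℝ³) → L⁶ ∩ L^∞` (`memLp_of_eLpNorm_fderiv_lt_top`, Adams 1975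
Corollary 5.16); in particular `‖v‖_{L^r} < ∞`. [cite: Adams1975, Corollary 5.16; MajdaBertozziCUP2002, (11.9)] -/
theorem eLpNorm_lt_top_of_curl_of_six_lt {r : ℝ≥0∞} (hr6 : 6 < r) (hrtop : r ≠ ⊤)
    {v : EuclideanSpace ℝ (Fin 3) → EuclideanSpace ℝ (Fin 3)} (hv : ContDiff ℝ ∞ v)
    (hdiv : VectorCalculus.IsDivFree v) (hv2 : eLpNorm v 2 volume < ⊤)
    (hDv : eLpNorm (fderiv ℝ v) 2 volume < ⊤) (hω : eLpNorm (curl v) r volume < ⊤) :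
    eLpNorm v r volume < ⊤ := by
  have hvc : Continuous v := hv.continuous
  have hDc : Continuous (fderiv ℝ v) := hv.continuous_fderiv (by simp)
  have hωc : Continuous (curl v) := continuous_curl (hv.of_le one_le_infty)
  have hr0 : r ≠ 0 := (lt_trans (by norm_num) hr6).ne'
  have h6r : (6 : ℝ) < r.toReal := by
    have h := (ENNReal.toReal_lt_toReal ENNReal.ofNat_ne_top hrtop).2 hr6
    simpa using h
  -- `v ∈ L⁶`
  have h6 : eLpNorm v 6 volume < ⊤ := by
    refine lt_of_le_of_lt (eLpNorm_six_le_eLpNorm_fderiv_two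
      (volume : Measure (EuclideanSpace ℝ (Fin 3))) (F := EuclideanSpace ℝ (Fin 3))
      finrank_euclideanSpace_fin (hv.of_le one_le_infty) hv2) ?_
    exact ENNReal.mul_lt_top ENNReal.coe_lt_top hDv
  -- `curl v ∈ L²`, from `|curl v| ≤ ‖curlCLM‖ |Dv|`
  have hω2 : eLpNorm (curl v) 2 volume < ⊤ := by
    refine lt_of_le_of_lt (eLpNorm_le_mul_eLpNorm_of_ae_le_mul
      (Eventually.of_forall fun x => norm_curl_le v x) 2) ?_
    exact ENNReal.mul_lt_top ENNReal.ofReal_lt_top hDv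
  -- `curl v ∈ L⁶` by interpolation between `2` and `r`
  have hω6 : eLpNorm (curl v) 6 volume < ⊤ := by
    have hfin2 : ∫⁻ x, ‖curl v x‖ₑ ^ (2 : ℝ) < ⊤ := by
      have h := (eLpNorm_lt_top_iff_lintegral_rpow_enorm_lt_top (by norm_num) (by norm_num)).1 hω2
      simpa using h
    have hfinr : ∫⁻ x, ‖curl v x‖ₑ ^ r.toReal < ⊤ :=
      (eLpNorm_lt_top_iff_lintegral_rpow_enorm_lt_top hr0 hrtop).1 hω
    have hint := lintegral_rpow_interpolate (μ := volume)
      (f := fun x => ‖curl v x‖ₑ) hωc.measurable.enorm.aemeasurable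
      (a := 2) (b := r.toReal) (r := 6) (by norm_num) (by linarith) (by norm_num) h6r.le
    rw [eLpNorm_lt_top_iff_lintegral_rpow_enorm_lt_top (by norm_num) (by norm_num)]
    simp only [ENNReal.toReal_ofNat]
    refine lt_of_le_of_lt hint (ENNReal.mul_lt_top ?_ ?_)
    · exact ENNReal.rpow_lt_top_of_nonneg (div_nonneg (by linarith) (by linarith)) hfin2.ne
    · exact ENNReal.rpow_lt_top_of_nonneg (div_nonneg (by norm_num) (by linarith)) hfinr.ne
  -- `Dv ∈ L⁶` by the div–curl estimate with the `L⁶` tail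
  have hD6 : eLpNorm (fderiv ℝ v) 6 volume < ⊤ := by
    obtain ⟨C₆, hC₆⟩ := exists_eLpNorm_fderiv_le_curl_of_isDivFree_of_eLpNorm_lt_top
      (p := 6) (s := 6) (by norm_num) le_rfl (by norm_num) (by simp)
    exact lt_of_le_of_lt (hC₆ v hv hdiv h6) (ENNReal.mul_lt_top ENNReal.coe_lt_top hω6)
  -- Morrey: `v ∈ L⁶`, `Dv ∈ L⁶` ⇒ `v ∈ L^r`
  exact (memLp_of_eLpNorm_fderiv_lt_top (F := EuclideanSpace ℝ (Fin 3)) (p := 6) (r := r)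
    (by norm_num) (by norm_num) hr6.le (hv.of_le (by norm_cast)) h6 hD6).eLpNorm_lt_top

/-- **Beirão da Veiga's criterion in vorticity form on `ℝ³`, full range `3/2 < r < ∞`.** Let
`ν > 0`, `T > 0`, and let `(u, p)` be a classical solution of the unforced Navier–Stokes system on
`ℝ³ × [0, T)` which is Leray–Hopf from the rapidly decaying datum `u 0`. If the vorticity
satisfies `ω = curl u ∈ L^q(0, T; L^r(ℝ³))` with `2/q + 3/r = 2` and `1 < q < ∞` (equivalently
`3/2 < r < ∞`), then `u` extends to a classical solution past `T`. Printed (Beirão da Veiga 1995,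
as restated by Chae): "if the vorticity `ω = curl v` of the weak solution `v` satisfies
`ω ∈ L^r(0,T; L^p(ℝ³))`, `2/r + 3/p ≤ 2`, for `3/2 < p ≤ ∞`, then `v` becomes regular"; this
theorem is the equality case for classical Leray–Hopf solutions and finite space exponent (the
endpoint `p = ∞`, i.e. `ω ∈ L¹(0,T; L^∞)`, is the Beale–Kato–Majda criterion and is not part of
this statement). Proof: for `r ≤ 6`, `BeiraoDaVeiga1995_vorticityCriterion_of_le_six`; for
`r > 6`, a.e. slice has `∇u(t) ∈ L²` (Leray–Hopf dissipation) and `ω(t) ∈ L^r`, hence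
`u(t) ∈ L^r` (`eLpNorm_lt_top_of_curl_of_six_lt`: interpolation, div–curl with the `L⁶` tail,
Morrey's embedding), hence `‖∇u(t)‖_{L^r} ≤ C_r ‖ω(t)‖_{L^r}` by the div–curl estimate with the
`L^r` tail (Calderón–Zygmund, Majda–Bertozzi (11.9)); so `∇u ∈ L^q(0,T; L^r)` and the gradient
form `BeiraoDaVeiga1995_gradientCriterion_holds` concludes. [cite: Chae2007RMI, p. 372 (1.8) (restating Beirão da Veiga, C. R. Acad. Sci. Paris 321 (1995) 405–408); BerselliGaldi2002, (1.3) p. 3586; MajdaBertozziCUP2002, (11.9)] -/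
theorem BeiraoDaVeiga1995_vorticityCriterion :
    ∀ (ν T : ℝ), 0 < ν → 0 < T →
    ∀ (u : ℝ → EuclideanSpace ℝ (Fin 3) → EuclideanSpace ℝ (Fin 3))
      (p : ℝ → EuclideanSpace ℝ (Fin 3) → ℝ),
      IsClassicalNSSolutionOn (Ico 0 T) ν 0 u p →
      IsLerayHopfOn T ν 0 (u 0) u →
      HasRapidSpatialDecay (u 0) →
      ∀ (q r : ℝ≥0∞), 1 < q → q < ⊤ → 2 / q + 3 / r = 2 →
        MemLqLp q r (fun t x => curl (u t) x) (Ioo 0 T) →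
        HasSmoothExtensionPast ν 0 u T := by
  intro ν T hν hT u p hns hlh hdec q r h1q hqtop hqr hω
  by_cases hr6 : r ≤ 6
  · exact BeiraoDaVeiga1995_vorticityCriterion_of_le_six ν T hν hT u p hns hlh hdec q r h1q hqtop
      hqr hr6 hω
  rw [not_le] at hr6
  obtain ⟨hrtop, -, -⟩ := bdv_exponents h1q hqtop hqr
  have h1r : 1 < r := lt_trans (by norm_num) hr6
  -- the div–curl constant at `p = s = r` (gap `0`)
  obtain ⟨C, hC⟩ := exists_eLpNorm_fderiv_le_curl_of_isDivFree_of_eLpNorm_lt_top (p := r) (s := r)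
    h1r le_rfl hrtop.lt_top (by simp)
  -- the a.e. slice bound
  have key : ∀ᵐ t ∂(volume.restrict (Ioo 0 T)),
      eLpNorm (fderiv ℝ (u t)) r volume ≤ C * eLpNorm (curl (u t)) r volume := by
    obtain ⟨hω1, -⟩ := hω
    filter_upwards [ae_restrict_mem measurableSet_Ioo, ae_eLpNorm_fderiv_two_lt_top hns hlh hT, hω1]
      with t ht hDt hωt
    have htI : t ∈ Ico 0 T := Ioo_subset_Ico_self ht
    have h1 : ContDiff ℝ ∞ (u t) := hns.contDiff_velocity htI
    have h2 : VectorCalculus.IsDivFree (u t) := hns.divFree t htI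
    have h3 : eLpNorm (u t) 2 volume < ⊤ := eLpNorm_two_slice_lt_top hlh hν htI
    exact hC (u t) h1 h2
      (eLpNorm_lt_top_of_curl_of_six_lt hr6 hrtop h1 h2 h3 hDt hωt.eLpNorm_lt_top)
  exact BeiraoDaVeiga1995_gradientCriterion_holds ν T hν hT u p hns hlh hdec q r h1q hqtop hqr
    (memLqLp_fderiv_of_ae_le hns key hω)

end VorticityForm

end Literature.Analysis.FluidPDE
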